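import Literature.MathematicalPhysics.QuantumFieldTheory.SUNBakryEmeryPoincare
import HarnessLib

/-!
# The heat flow on polynomial functions of `SU(N)` and its minimum principle

Technical core of the DYNAMIC Bakry–Émery argument on `SU(N)` (Bakry–Émery 1985; Bakry–Gentil–Ledoux 2014,
§5.7) carried out WITHOUT analytic semigroup theory: the Laplace–Beltrami operator `Δ = ∑_α D_α²` of
`SUNBakryEmeryPoincare.lean` preserves the finite-dimensional spaces `𝒫_n` of polynomial functions in the real
coordinates of `M_N(ℂ)` (`Lap_mem_polySpace`), so the heat flow `∂_t p_t = Δ p_t` on `𝒫_n` is a linear ODE in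
finitely many coordinates, solved by the exponential of a continuous linear map.  We export it in coordinate form
(`exists_polyFlow`: `p_t = ∑_i c_i(t) b_i` with fixed polynomials `b_i`, differentiable coefficients and
`Δ p_t = ∑_i c_i'(t) b_i`), and prove for such flows:

* `deriv2_nonneg_of_forall_le`, `hasDerivAt_nonpos_of_forall_le_left` — the two one-variable facts used by the
  parabolic minimum principle (second-order condition at a minimum; one-sided Fermat);
* `Lap_nonneg_of_forall_le` — at a minimum point of `F|_{SU(N)}`, `ΔF ≥ 0` (each `D_α D_α F` is the second derivative
  of `F` along the one-parameter subgroup `s ↦ g e^{sY_α} ⊂ SU(N)`);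
* ★ `polyFlow_ge_of_ge` — the PARABOLIC MINIMUM PRINCIPLE: a polynomial heat flow with `p_0 ≥ m` on `SU(N)` has
  `p_t ≥ m` on `SU(N)` for all `t ≥ 0` (positivity preservation of `e^{tΔ}` on `𝒫_n`, proved by the classical
  `p_t + εt` argument on the compact `[0,T] × SU(N)`);
* `polyFlow_integral_eq` — conservation of mass `∫ p_t dσ = ∫ p_0 dσ` (`∫ Δ = 0`).

These are the inputs of the log-Sobolev inequality for the Haar measure of `SU(N)` (sequel file).  All statements are
about ambient smooth functions restricted to `SU(N)`, as in the rest of the `SUNBakryEmery` files; no definition is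
introduced (the flow is carried as explicit coordinate data).

## References

* D. Bakry, M. Émery, *Diffusions hypercontractives*, Sém. Probab. XIX, LNM 1123 (1985) 177–206.
* D. Bakry, I. Gentil, M. Ledoux, *Analysis and Geometry of Markov Diffusion Operators*, Grundlehren 348 (2014),
  §1.16 (finite-dimensional models), Prop. 5.7.1.
* A. Guionnet, *Large Random Matrices: Lectures on Macroscopic Asymptotics*, LNM 1957 (2009), §4.2, Thm. 4.6
  (the semigroup proof of the Bakry–Émery theorem).
-/

noncomputable section

open scoped Matrix ComplexConjugate BigOperators

namespace Literature.MathematicalPhysics.QuantumFieldTheory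

namespace SUNBakryEmery

open scoped Matrix.Norms.Frobenius ContDiff Topology
open Matrix Complex Finset MeasureTheory Filter Set

variable {N : ℕ}

/-! ### Two one-variable lemmas -/

/-- **Second-order condition at a minimum**: if `φ` is differentiable with derivative `φ'`, `φ'` is differentiable
at `0` with derivative `φ''`, and `φ(0) ≤ φ(s)` for all `s`, then `0 ≤ φ''` (Fermat gives `φ'(0) = 0`; if `φ'' < 0`
then `φ' < 0` on some `(0,u)` and the mean value theorem contradicts minimality); one-variable step of the positivity of
the semigroup used throughout the Bakry–Émery argument. [cite: BakryGentilLedoux2014, §1.2 (positivity preserving property of Markov semigroups; proof device)] -/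
theorem deriv2_nonneg_of_forall_le {φ φ' : ℝ → ℝ} {φ'' : ℝ} (hφ : ∀ s, HasDerivAt φ (φ' s) s)
    (hφ' : HasDerivAt φ' φ'' 0) (hmin : ∀ s, φ 0 ≤ φ s) : 0 ≤ φ'' := by
  by_contra h
  push Not at h
  have h0 : φ' 0 = 0 := IsLocalMin.hasDerivAt_eq_zero (Filter.Eventually.of_forall hmin) (hφ 0)
  have ht : Tendsto (fun t : ℝ => t⁻¹ • (φ' (0 + t) - φ' 0)) (𝓝[>] 0) (𝓝 φ'') := hφ'.tendsto_slope_zero_right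
  have hev : ∀ᶠ t in 𝓝[>] (0 : ℝ), φ' t < 0 := by
    have h1 : ∀ᶠ t in 𝓝[>] (0 : ℝ), t⁻¹ • (φ' (0 + t) - φ' 0) < 0 := ht (Iio_mem_nhds h)
    have h2 : ∀ᶠ t in 𝓝[>] (0 : ℝ), (0 : ℝ) < t := self_mem_nhdsWithin
    filter_upwards [h1, h2] with t h1 h2
    rw [h0, sub_zero, zero_add, smul_eq_mul] at h1
    by_contra hc
    push Not at hc
    exact absurd h1 (not_lt.2 (mul_nonneg (inv_nonneg.2 h2.le) hc))
  obtain ⟨u, hu, hsub⟩ := mem_nhdsGT_iff_exists_Ioo_subset.1 hev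
  have hu' : (0 : ℝ) < u := hu
  have hu2 : (0 : ℝ) < u / 2 := by linarith
  have hcont : ContinuousOn φ (Icc 0 (u / 2)) := fun x _ => (hφ x).continuousAt.continuousWithinAt
  obtain ⟨ξ, hξ, hslope⟩ := exists_hasDerivAt_eq_slope φ φ' hu2 hcont (fun x _ => hφ x)
  have hξneg : φ' ξ < 0 := hsub ⟨hξ.1, hξ.2.trans (by linarith)⟩
  rw [hslope, sub_zero] at hξneg
  have hnum : φ (u / 2) - φ 0 < 0 := by
    rcases div_neg_iff.1 hξneg with ⟨_, h2⟩ | ⟨h1, _⟩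
    · exact absurd h2 (not_lt.2 hu2.le)
    · exact h1
  linarith [hmin (u / 2)]

/-- **One-sided Fermat**: if `ψ` has derivative `d` at `t₀` and `ψ(t₀) ≤ ψ(t)` for all `t ∈ [a, t₀]` with `a < t₀`,
then `d ≤ 0` (left difference quotients are `≤ 0`); one-variable step of the positivity of the semigroup.
[cite: BakryGentilLedoux2014, §1.2 (positivity preserving property of Markov semigroups; proof device)] -/
theorem hasDerivAt_nonpos_of_forall_le_left {ψ : ℝ → ℝ} {d t₀ a : ℝ} (ha : a < t₀) (hψ : HasDerivAt ψ d t₀)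
    (hmin : ∀ t ∈ Icc a t₀, ψ t₀ ≤ ψ t) : d ≤ 0 := by
  have ht : Tendsto (fun t : ℝ => t⁻¹ • (ψ (t₀ + t) - ψ t₀)) (𝓝[<] 0) (𝓝 d) := hψ.tendsto_slope_zero_left
  have hev : ∀ᶠ t in 𝓝[<] (0 : ℝ), t⁻¹ • (ψ (t₀ + t) - ψ t₀) ≤ 0 := by
    have h1 : ∀ᶠ t in 𝓝[<] (0 : ℝ), a - t₀ < t := by
      have : Ioo (a - t₀) 0 ∈ 𝓝[<] (0 : ℝ) := Ioo_mem_nhdsLT (by linarith)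
      filter_upwards [this] with t ht using ht.1
    have h2 : ∀ᶠ t in 𝓝[<] (0 : ℝ), t < 0 := self_mem_nhdsWithin
    filter_upwards [h1, h2] with t h1 h2
    have hnum : 0 ≤ ψ (t₀ + t) - ψ t₀ := by
      have := hmin (t₀ + t) ⟨by linarith, by linarith⟩
      linarith
    rw [smul_eq_mul]
    exact mul_nonpos_of_nonpos_of_nonneg (inv_nonpos.2 h2.le) hnum
  exact le_of_tendsto ht hev

/-! ### At a minimum point of `F|_{SU(N)}`, `ΔF ≥ 0` -/

section MinLap


/-- Along the one-parameter subgroup `s ↦ Q e^{sY}`, the second derivative of `F` is `D_Y D_Y F` (Shen–Zhu–Zhu §2, (2.4):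
left-invariant derivatives as derivatives along `Q e^{tX}`). [cite: arXiv220412737, §2 (2.4) (p. 10)] -/
theorem hasDerivAt_matD_comp_mul_exp {F : Matrix (Fin N) (Fin N) ℂ → ℝ} (hF : ContDiff ℝ ∞ F)
    (Q A : Matrix (Fin N) (Fin N) ℂ) (t : ℝ) :
    HasDerivAt (fun s : ℝ => matD A F (Q * NormedSpace.exp (s • A)))
      (matD A (matD A F) (Q * NormedSpace.exp (t • A))) t :=
  hasDerivAt_comp_mul_exp (contDiff_matD hF A) Q A t

/-- **`ΔF(g₀) ≥ 0` at a minimum point `g₀` of `F` on `SU(N)`**: for each frame direction, `s ↦ F(g₀ e^{sY_α})` is a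
smooth function on `ℝ` (valued on `SU(N)`) with a global minimum at `s = 0`, so its second derivative
`D_α D_α F(g₀)` is `≥ 0` — the pointwise form of the positivity (minimum principle) of the diffusion generator
`Δ = ∑_α D_α²`. [cite: BakryGentilLedoux2014, §1.2 and §1.16 (positivity of diffusion semigroups / compact manifold models; proof device)] -/
theorem Lap_nonneg_of_forall_le (hN : N ≠ 0) {F : Matrix (Fin N) (Fin N) ℂ → ℝ} (hF : ContDiff ℝ ∞ F)
    {g₀ : SUN N} (hmin : ∀ g : SUN N, F g₀ ≤ F g) : 0 ≤ Lap F (g₀ : Matrix (Fin N) (Fin N) ℂ) := by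
  unfold Lap
  refine sum_nonneg fun α _ => ?_
  set Y := frame (N := N) α
  have hY : Yᴴ = -Y := frame_conjTranspose α
  have hY0 : Y.trace = 0 := frame_trace hN α
  set φ : ℝ → ℝ := fun s => F ((g₀ : Matrix (Fin N) (Fin N) ℂ) * NormedSpace.exp (s • Y)) with hφ
  set φ' : ℝ → ℝ := fun s => matD Y F ((g₀ : Matrix (Fin N) (Fin N) ℂ) * NormedSpace.exp (s • Y)) with hφ'
  have h1 : ∀ s, HasDerivAt φ (φ' s) s := fun s => hasDerivAt_comp_mul_exp hF _ Y s
  have h2 : HasDerivAt φ' (matD Y (matD Y F) ((g₀ : Matrix (Fin N) (Fin N) ℂ) * NormedSpace.exp ((0 : ℝ) • Y))) 0 :=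
    hasDerivAt_matD_comp_mul_exp hF _ Y 0
  rw [zero_smul, NormedSpace.exp_zero, Matrix.mul_one] at h2
  refine deriv2_nonneg_of_forall_le h1 h2 fun s => ?_
  have hmem : (g₀ : Matrix (Fin N) (Fin N) ℂ) * NormedSpace.exp (s • Y) =
      ((g₀ * expSU hY hY0 s : SUN N) : Matrix (Fin N) (Fin N) ℂ) := rfl
  simp only [hφ, zero_smul, NormedSpace.exp_zero, Matrix.mul_one]
  rw [hmem]
  exact hmin _

end MinLap

/-! ### The heat flow on `𝒫_n` in coordinates -/

section Flow


/-- `Δ` restricted to the finite-dimensional space `𝒫_n`, as a linear endomorphism (the `Δ`-invariance `Δ𝒫_n ⊆ 𝒫_n` of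
the polynomial = `SU(N)`-finite functions). [cite: BakryGentilLedoux2014, §1.16 and §2.7 (operators preserving polynomial spaces; proof device)] -/
theorem exists_linearMap_Lap (n : ℕ) :
    ∃ T : polySpace N n →ₗ[ℝ] polySpace N n, ∀ p : polySpace N n, ((T p : polySpace N n) : Matrix (Fin N) (Fin N) ℂ → ℝ) = Lap p.1 := by
  refine ⟨{ toFun := fun p => ⟨Lap p.1, Lap_mem_polySpace p.2⟩, map_add' := ?_, map_smul' := ?_ }, fun p => rfl⟩
  · intro p q
    ext Q
    have := Lap_add (contDiff_of_mem_polySpace p.2) (contDiff_of_mem_polySpace q.2)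
    exact congrFun this Q
  · intro r p
    ext Q
    have := Lap_smul r (contDiff_of_mem_polySpace p.2)
    exact congrFun this Q

/-- **The heat flow on `𝒫_n`, in coordinates.**  For every `p ∈ 𝒫_n` there are finitely many polynomials
`b_i ∈ 𝒫_n`, differentiable coefficient functions `c_i : ℝ → ℝ` with continuous derivatives `c_i'`, such that
`p = ∑_i c_i(0) b_i` and the family `p_t := ∑_i c_i(t) b_i` solves the heat equation `Δ p_t = ∑_i c_i'(t) b_i = ∂_t p_t`
(the coefficients are `c(t) = e^{tA} c(0)` for the matrix `A` of `Δ|_{𝒫_n}` in a basis).  This is the semigroup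
`e^{tΔ}` on the `Δ`-invariant finite-dimensional space `𝒫_n`, with no analysis (the semigroup `P_t = e^{tL}` of the
Bakry–Émery argument, BGL §5.7 p. 269, realised on polynomials).
[cite: BakryGentilLedoux2014, §1.4 and §5.7 p. 269 (the Markov semigroup P_t = e^{tL} solving the heat equation ∂_t P_t f = L P_t f; proof device)] -/
theorem exists_polyFlow {n : ℕ} {p : Matrix (Fin N) (Fin N) ℂ → ℝ} (hp : p ∈ polySpace N n) :
    ∃ (d : ℕ) (b : Fin d → Matrix (Fin N) (Fin N) ℂ → ℝ) (c c' : ℝ → Fin d → ℝ),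
      (∀ i, b i ∈ polySpace N n) ∧ (p = fun Q => ∑ i, c 0 i * b i Q) ∧
      (∀ t i, HasDerivAt (fun s => c s i) (c' t i) t) ∧ (∀ i, Continuous fun t => c' t i) ∧
      (∀ t, Lap (fun Q => ∑ i, c t i * b i Q) = fun Q => ∑ i, c' t i * b i Q) := by
  classical
  obtain ⟨T, hT⟩ := exists_linearMap_Lap (N := N) n
  set d := Module.finrank ℝ (polySpace N n)
  set bP : Module.Basis (Fin d) ℝ (polySpace N n) := Module.finBasis ℝ (polySpace N n)
  set e : polySpace N n ≃ₗ[ℝ] (Fin d → ℝ) := bP.equivFun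
  -- the coordinate version of `Δ|_{𝒫_n}` as a continuous linear map of `ℝ^d`
  set A₀ : (Fin d → ℝ) →ₗ[ℝ] (Fin d → ℝ) := e.toLinearMap ∘ₗ T ∘ₗ e.symm.toLinearMap
  set A : (Fin d → ℝ) →L[ℝ] (Fin d → ℝ) := LinearMap.toContinuousLinearMap A₀
  set v₀ : Fin d → ℝ := e ⟨p, hp⟩
  set c : ℝ → Fin d → ℝ := fun t => NormedSpace.exp (t • A) v₀ with hc
  set c' : ℝ → Fin d → ℝ := fun t => A (c t) with hc'
  set b : Fin d → Matrix (Fin N) (Fin N) ℂ → ℝ := fun i => (bP i : polySpace N n).1 with hb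
  -- derivative of the exponential
  have hexp : ∀ t, HasDerivAt (fun s : ℝ => NormedSpace.exp (s • A)) (A * NormedSpace.exp (t • A)) t :=
    fun t => hasDerivAt_exp_smul_const' (𝕂 := ℝ) A t
  have hcd : ∀ t i, HasDerivAt (fun s => c s i) (c' t i) t := by
    intro t i
    -- evaluation `S ↦ (S v₀) i` is a continuous linear map
    set ev : ((Fin d → ℝ) →L[ℝ] (Fin d → ℝ)) →L[ℝ] ℝ :=
      (ContinuousLinearMap.proj i : (Fin d → ℝ) →L[ℝ] ℝ).comp (ContinuousLinearMap.apply ℝ (Fin d → ℝ) v₀)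
    have h : HasDerivAt (fun s => ev (NormedSpace.exp (s • A))) (ev (A * NormedSpace.exp (t • A))) t :=
      ev.hasFDerivAt.comp_hasDerivAt t (hexp t)
    have e1 : (fun s => ev (NormedSpace.exp (s • A))) = fun s => c s i := by
      funext s; rfl
    have e2 : ev (A * NormedSpace.exp (t • A)) = c' t i := by rfl
    rw [e1, e2] at h
    exact h
  -- reconstruction: a polynomial is the sum of its coordinates times the basis
  have hrecon : ∀ q : polySpace N n, (q : Matrix (Fin N) (Fin N) ℂ → ℝ) = fun Q => ∑ i, e q i * b i Q := by
    intro q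
    have h1 : q = ∑ i, e q i • bP i := (bP.sum_equivFun q).symm
    funext Q
    have h2 := congrArg (fun r : polySpace N n => (r : Matrix (Fin N) (Fin N) ℂ → ℝ) Q) h1
    simp only [Submodule.coe_sum, Submodule.coe_smul, Finset.sum_apply, Pi.smul_apply, smul_eq_mul] at h2
    exact h2
  -- the polynomial with coordinates `w`
  have hpoly : ∀ w : Fin d → ℝ, (fun Q => ∑ i, w i * b i Q) = ((e.symm w : polySpace N n) : Matrix (Fin N) (Fin N) ℂ → ℝ) := by
    intro w
    have h := hrecon (e.symm w)
    rw [h]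
    simp only [LinearEquiv.apply_symm_apply]
  refine ⟨d, b, c, c', fun i => (bP i).2, ?_, hcd, ?_, ?_⟩
  · -- `p = ∑ c 0 i • b i`
    have h0 : c 0 = v₀ := by simp [hc]
    rw [h0]
    exact hrecon ⟨p, hp⟩
  · intro i
    have hcc : Continuous c := continuous_pi fun j => continuous_iff_continuousAt.2 fun t => (hcd t j).continuousAt
    exact (continuous_apply i).comp (A.continuous.comp hcc)
  · intro t
    rw [hpoly (c t), hpoly (c' t), ← hT]
    -- `T (e.symm (c t)) = e.symm (A (c t))`
    have hTA : T (e.symm (c t)) = e.symm (c' t) := by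
      have : c' t = e (T (e.symm (c t))) := by
        simp only [hc', A, A₀, LinearMap.coe_toContinuousLinearMap', LinearMap.coe_comp, Function.comp_apply,
          LinearEquiv.coe_coe]
      rw [this, LinearEquiv.symm_apply_apply]
    rw [hTA]

end Flow

/-! ### The parabolic minimum principle for polynomial heat flows -/

/-- Smoothness of a coordinate combination `∑_i w_i b_i` of smooth functions (plumbing).
[cite: BakryGentilLedoux2014, §5.7 p. 269 (proof device)] -/
theorem contDiff_sum_mul {d : ℕ} {b : Fin d → Matrix (Fin N) (Fin N) ℂ → ℝ} (hb : ∀ i, ContDiff ℝ ∞ (b i))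
    (w : Fin d → ℝ) : ContDiff ℝ ∞ (fun Q => ∑ i, w i * b i Q) :=
  ContDiff.sum fun i _ => contDiff_const.mul (hb i)

/-- ★ **Parabolic minimum principle / positivity of `e^{tΔ}` on `𝒫_n`.**  Let `p_t = ∑_i c_i(t) b_i` be a family of
smooth ambient functions with differentiable coefficients, `∂_t p_t = ∑ c_i' b_i`, satisfying the heat equation
`Δ p_t = ∂_t p_t` on `SU(N)`.  If `m ≤ p_0` on `SU(N)` then `m ≤ p_t` on `SU(N)` for every `t ≥ 0`.
Proof: for `ε > 0` the continuous function `v(s,g) = p_s(g) + εs` attains its minimum on the compact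
`[0,t] × SU(N)` at some `(s₀,g₀)`; if `s₀ > 0` then `g₀` minimises `p_{s₀}` so `Δp_{s₀}(g₀) ≥ 0`
(`Lap_nonneg_of_forall_le`) and `∂_s v(s₀,g₀) = Δp_{s₀}(g₀) + ε > 0`, contradicting the one-sided Fermat lemma in
`s`; hence `s₀ = 0` and `p_s + εs ≥ m`.  This is the positivity preserving property `f ≥ 0 ⇒ P_t f ≥ 0` of the Markov
semigroup (BGL Definition 1.2.1/(1.2.2)) for `P_t = e^{tΔ}` on `𝒫_n ⊂ C(SU(N))`.
[cite: BakryGentilLedoux2014, §1.2 (1.2.2) (positivity preserving property of P_t, here proved for e^{tΔ} on 𝒫_n)] -/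
theorem polyFlow_ge_of_ge (hN : N ≠ 0) {d : ℕ} {b : Fin d → Matrix (Fin N) (Fin N) ℂ → ℝ}
    (hb : ∀ i, ContDiff ℝ ∞ (b i)) {c c' : ℝ → Fin d → ℝ} (hc : ∀ t i, HasDerivAt (fun s => c s i) (c' t i) t)
    (hheat : ∀ t, ∀ g : SUN N, Lap (fun Q => ∑ i, c t i * b i Q) (g : Matrix (Fin N) (Fin N) ℂ) =
      ∑ i, c' t i * b i (g : Matrix (Fin N) (Fin N) ℂ))
    {m : ℝ} (h0 : ∀ g : SUN N, m ≤ ∑ i, c 0 i * b i (g : Matrix (Fin N) (Fin N) ℂ)) {t : ℝ} (ht : 0 ≤ t)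
    (g : SUN N) : m ≤ ∑ i, c t i * b i (g : Matrix (Fin N) (Fin N) ℂ) := by
  -- the flow and its regularity
  set P : ℝ → SUN N → ℝ := fun s g => ∑ i, c s i * b i (g : Matrix (Fin N) (Fin N) ℂ) with hP
  have hcc : ∀ i, Continuous fun s => c s i := fun i =>
    continuous_iff_continuousAt.2 fun s => (hc s i).continuousAt
  have hPcont : Continuous (Function.uncurry P) := by
    refine continuous_finsetSum _ fun i _ => ?_
    exact ((hcc i).comp continuous_fst).mul
      (((hb i).continuous.comp continuous_subtype_val).comp continuous_snd)
  have hPderiv : ∀ s (g : SUN N), HasDerivAt (fun s' => P s' g)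
      (Lap (fun Q => ∑ i, c s i * b i Q) (g : Matrix (Fin N) (Fin N) ℂ)) s := by
    intro s g
    rw [hheat s g]
    exact HasDerivAt.fun_sum (u := Finset.univ) (A := fun i s' => c s' i * b i (g : Matrix (Fin N) (Fin N) ℂ))
      (A' := fun i => c' s i * b i (g : Matrix (Fin N) (Fin N) ℂ)) (x := s) fun i _ => (hc s i).mul_const _
  -- ε-argument
  refine le_of_forall_pos_lt_add fun ε hε => ?_
  -- hmm we show m ≤ P t g + ε * t + ... ; organise as: for all ε > 0, m - ε * t - ε ≤ P t g? Simpler: m ≤ P t g + ε(t+1).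
  have key : ∀ ε : ℝ, 0 < ε → m ≤ P t g + ε * t := by
    intro ε hε
    set v : ℝ × SUN N → ℝ := fun z => P z.1 z.2 + ε * z.1 with hv
    have hvcont : Continuous v := hPcont.add (continuous_const.mul continuous_fst)
    have hK : IsCompact (Icc (0 : ℝ) t ×ˢ (univ : Set (SUN N))) := isCompact_Icc.prod isCompact_univ
    have hKne : (Icc (0 : ℝ) t ×ˢ (univ : Set (SUN N))).Nonempty := ⟨(0, g), ⟨⟨le_rfl, ht⟩, mem_univ _⟩⟩
    obtain ⟨⟨s₀, g₀⟩, hmem, hmin⟩ := hK.exists_isMinOn hKne hvcont.continuousOn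
    have hs₀ : s₀ ∈ Icc (0 : ℝ) t := (mem_prod.1 hmem).1
    -- the minimum is attained at `s₀ = 0`
    have hs₀0 : s₀ = 0 := by
      by_contra hne
      have hpos : 0 < s₀ := lt_of_le_of_ne hs₀.1 (Ne.symm hne)
      -- spatial minimum ⇒ `Δ p_{s₀}(g₀) ≥ 0`
      have hsp : ∀ g' : SUN N, (fun Q => ∑ i, c s₀ i * b i Q) (g₀ : Matrix (Fin N) (Fin N) ℂ) ≤
          (fun Q => ∑ i, c s₀ i * b i Q) (g' : Matrix (Fin N) (Fin N) ℂ) := by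
        intro g'
        have := hmin (a := (s₀, g')) ⟨hs₀, mem_univ _⟩
        simp only [hv, hP] at this
        simpa using this
      have hLap := Lap_nonneg_of_forall_le hN (contDiff_sum_mul hb (c s₀)) hsp
      -- temporal one-sided Fermat
      have hd : HasDerivAt (fun s => v (s, g₀))
          (Lap (fun Q => ∑ i, c s₀ i * b i Q) (g₀ : Matrix (Fin N) (Fin N) ℂ) + ε * 1) s₀ := by
        exact (hPderiv s₀ g₀).add ((hasDerivAt_id s₀).const_mul ε)
      have hle := hasDerivAt_nonpos_of_forall_le_left hpos hd fun s hs => by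
        have := hmin (a := (s, g₀)) ⟨⟨hs.1, hs.2.trans hs₀.2⟩, mem_univ _⟩
        simpa using this
      linarith
    -- conclude
    have h1 : v (s₀, g₀) ≤ v (t, g) := hmin ⟨⟨ht, le_rfl⟩, mem_univ _⟩
    rw [hs₀0] at h1
    simp only [hv, hP, mul_zero, add_zero] at h1
    have h2 := h0 g₀
    simp only [hP]
    linarith
  have := key (ε / (t + 1)) (div_pos hε (by linarith))
  have hlt : ε / (t + 1) * t < ε := by
    rw [div_mul_eq_mul_div, div_lt_iff₀ (by linarith)]
    nlinarith
  simp only [hP] at this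
  linarith

/-! ### Conservation of mass -/

/-- **`∫ p_t dσ = ∫ p_0 dσ`** along a polynomial heat flow (`d/dt ∫ p_t = ∫ Δ p_t dσ = 0`): invariance of the Haar
measure under `P_t` (BGL «invariant measure», `∫ P_t f dμ = ∫ f dμ`).
[cite: BakryGentilLedoux2014, §1.2 and (1.6.2) (invariant measure: ∫ P_t f dμ = ∫ f dμ, ∫ Lf dμ = 0)] -/
theorem polyFlow_integral_eq (hN : N ≠ 0) {d : ℕ} {b : Fin d → Matrix (Fin N) (Fin N) ℂ → ℝ}
    (hb : ∀ i, ContDiff ℝ ∞ (b i)) {c c' : ℝ → Fin d → ℝ} (hc : ∀ t i, HasDerivAt (fun s => c s i) (c' t i) t)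
    (hheat : ∀ t, Lap (fun Q => ∑ i, c t i * b i Q) = fun Q => ∑ i, c' t i * b i Q) (t : ℝ) :
    ∫ g : SUN N, ∑ i, c t i * b i (g : Matrix (Fin N) (Fin N) ℂ) ∂(haarSU N) =
      ∫ g : SUN N, ∑ i, c 0 i * b i (g : Matrix (Fin N) (Fin N) ℂ) ∂(haarSU N) := by
  -- `∫ p_t = ∑ c_i(t) ∫ b_i`, whose derivative `∑ c_i'(t) ∫ b_i = ∫ Δ p_t = 0`
  have hint : ∀ i, Integrable (fun g : SUN N => b i (g : Matrix (Fin N) (Fin N) ℂ)) (haarSU N) :=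
    fun i => integrable_of_continuous_SUN (continuous_restrict (hb i)) _
  have hsum : ∀ w : Fin d → ℝ, ∫ g : SUN N, ∑ i, w i * b i (g : Matrix (Fin N) (Fin N) ℂ) ∂(haarSU N) =
      ∑ i, w i * ∫ g : SUN N, b i (g : Matrix (Fin N) (Fin N) ℂ) ∂(haarSU N) := by
    intro w
    rw [integral_finsetSum _ fun i _ => (hint i).const_mul _]
    exact sum_congr rfl fun i _ => integral_const_mul _ _
  set Φ : ℝ → ℝ := fun s => ∑ i, c s i * ∫ g : SUN N, b i (g : Matrix (Fin N) (Fin N) ℂ) ∂(haarSU N) with hΦ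
  have hderiv : ∀ s, HasDerivAt Φ 0 s := by
    intro s
    have h := HasDerivAt.fun_sum (u := Finset.univ)
      (A := fun i s' => c s' i * ∫ g : SUN N, b i (g : Matrix (Fin N) (Fin N) ℂ) ∂(haarSU N))
      (A' := fun i => c' s i * ∫ g : SUN N, b i (g : Matrix (Fin N) (Fin N) ℂ) ∂(haarSU N)) (x := s)
      fun i _ => (hc s i).mul_const _
    have hzero : ∑ i, c' s i * ∫ g : SUN N, b i (g : Matrix (Fin N) (Fin N) ℂ) ∂(haarSU N) = 0 := by
      rw [← hsum (c' s)]
      have h2 := integral_Lap hN (contDiff_sum_mul hb (c s))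
      rw [hheat s] at h2
      exact h2
    have e : Φ = fun s' => ∑ i, c s' i * ∫ g : SUN N, b i (g : Matrix (Fin N) (Fin N) ℂ) ∂(haarSU N) := by
      funext s'; simp [hΦ]
    rw [e, ← hzero]
    exact h
  have hconst := is_const_of_deriv_eq_zero (fun s => (hderiv s).differentiableAt) (fun s => (hderiv s).deriv) t 0
  rw [hsum, hsum]
  exact hconst

end SUNBakryEmery

end Literature.MathematicalPhysics.QuantumFieldTheory
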